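import Literature.Analysis.FluidPDE.ElgindiMomentCalculus
import Literature.Analysis.FluidPDE.ElgindiSelfSimilarEquations
import Literature.Analysis.FluidPDE.ElgindiWordCalculus
import Literature.Analysis.FluidPDE.ElgindiEulerODE
import Literature.Analysis.FluidPDE.ElgindiAdjointMode
import HarnessLib

/-!
# The polar model operator of §7 and the orthogonality of its solutions to `sin θ cos² θ`
([Elgindi2021] §7 eq. (PolarBSL), §7.1 Proposition 7.1 Step 1)

Topic `Literature/Analysis/FluidPDE`. Proof file (everything proved, no definitions, no named
facts) on the proof path of the named fact
`Literature.Analysis.FluidPDE.Elgindi.ElgindiGhoulMasmoudi2021_stabilityCore`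
(`ElgindiStabilityDecomposition.lean`). T. M. Elgindi, Ann. of Math. 194 (2021) =
arXiv:1904.04795, §7 (p. 19):

> "`L(Ψ) = −α²R²∂_RRΨ − α(5+α)R∂_RΨ − ∂_θθΨ + ∂_θ(tan(θ)Ψ) − 6Ψ = F.` We couple this equation
> with the natural boundary conditions on `Ψ`: `Ψ(R,0) = Ψ(R,π/2) = 0`, `lim_{R→∞}Ψ(R,θ) = 0`."
> (Step 1 of the proof of Proposition 7.1:) "under the conditions of the lemma
> [`∫₀^{π/2}F(R,θ)cos²θ sinθ dθ = 0` for every `R`], `Ψ` must also be orthogonal to `sinθcos²θ` …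
> Therefore, `Ψ_⋆ ≡ 0`."

The operator is the tree's `ellipticOp` (`ElgindiSelfSimilarEquations.lean`); on the open strip its
`tan`-term expands as `∂_θ(tanθΨ) = Ψ/cos²θ + sinθΨ_θ/cosθ` (`ellipticOp_eq_expanded`). This file
proves Step 1 for the a-priori class of `C²` profiles compactly supported in `ℝ²` with Dirichlet data
(`kMoment_eq_zero_of_ellipticOp_orthogonal`): with `K = 3sinθcos²θ` (`kernelK`),
`Ψ_⋆ = ⅓(K, Ψ(R,·))` (`kMoment`) satisfies `α²R²Ψ_⋆'' + α(5+α)RΨ_⋆' = −(K, LΨ(R,·))`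
(`integral_angularOp_mul_adjointMode`), so the Euler lemma (`eulerODE_eq_zero`) gives `Ψ_⋆ ≡ 0` on
`R > 0` whenever `(K, LΨ(R,·)) = 0` for all `R > 0`.
-/

noncomputable section

open MeasureTheory Set Real Filter Function intervalIntegral
open _root_.Topology

namespace Literature.Analysis.FluidPDE

namespace Elgindi

/-- **The `tan`-term of the elliptic operator, expanded on the open strip**:
`L(Ψ) = −α²R²Ψ_RR − α(5+α)RΨ_R − Ψ_θθ + (Ψ/cos²θ + sinθΨ_θ/cosθ) − 6Ψ` wherever `cosθ ≠ 0` and the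
slice `Ψ(R,·)` is differentiable. [cite: Elgindi2021, §7 eq. (PolarBSL) (p. 19 of arXiv:1904.04795)] -/
theorem ellipticOp_eq_expanded (α : ℝ) {Ψ : ℝ → ℝ → ℝ} {R θ : ℝ}
    (hd : DifferentiableAt ℝ (fun θ' => Ψ R θ') θ) (hθ : Real.cos θ ≠ 0) :
    ellipticOp α Ψ R θ = -α ^ 2 * R ^ 2 * dz (dz Ψ) R θ - α * (5 + α) * R * dz Ψ R θ - dθ (dθ Ψ) R θ +
      (Ψ R θ / Real.cos θ ^ 2 + Real.sin θ * dθ Ψ R θ / Real.cos θ) - 6 * Ψ R θ := by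
  have htan : dθ (fun z' θ' => Real.tan θ' * Ψ z' θ') R θ = Ψ R θ / Real.cos θ ^ 2 + Real.sin θ * dθ Ψ R θ / Real.cos θ := by
    show deriv (fun θ' => Real.tan θ' * Ψ R θ') θ = _
    have h : HasDerivAt (fun θ' => Real.tan θ' * Ψ R θ') (1 / Real.cos θ ^ 2 * Ψ R θ + Real.tan θ * deriv (fun θ' => Ψ R θ') θ) θ :=
      (Real.hasDerivAt_tan hθ).mul hd.hasDerivAt
    rw [h.deriv, Real.tan_eq_sin_div_cos]
    show 1 / Real.cos θ ^ 2 * Ψ R θ + Real.sin θ / Real.cos θ * dθ Ψ R θ = _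
    ring
  unfold ellipticOp
  rw [htan]

/-! ### Radial bound of the support -/

/-- A compactly supported function of two variables vanishes for large first coordinate. [folklore] -/
theorem exists_forall_le_eq_zero {Ψ : ℝ → ℝ → ℝ} (hs : HasCompactSupport (uncurry Ψ)) :
    ∃ b : ℝ, ∀ R, b ≤ R → ∀ θ, Ψ R θ = 0 := by
  obtain ⟨b, hb⟩ := (hs.isCompact.image continuous_fst).isBounded.bddAbove
  refine ⟨b + 1, fun R hR θ => ?_⟩
  have : (R, θ) ∉ tsupport (uncurry Ψ) := fun h => by
    have := hb (mem_image_of_mem Prod.fst h)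
    simp at this
    linarith
  have h0 : uncurry Ψ (R, θ) = 0 := image_eq_zero_of_notMem_tsupport this
  simpa using h0

/-! ### Step 1 -/

/-- **Solutions are orthogonal to `sinθcos²θ` when the data are** (Proposition 7.1, Step 1, for the
a-priori class): `α > 0`, `Ψ ∈ C²(ℝ²)` compactly supported with `Ψ(R,0) = Ψ(R,π/2) = 0`; if
`∫₀^{π/2}L(Ψ)(R,θ)K(θ)dθ = 0` for all `R > 0` (`K = 3sinθcos²θ`), then
`∫₀^{π/2}Ψ(R,θ)K(θ)dθ = 0` for all `R > 0`. [cite: Elgindi2021, §7.1 proof of Proposition 7.1, Step 1 (p. 19 of arXiv:1904.04795)] -/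
theorem kMoment_eq_zero_of_ellipticOp_orthogonal {α : ℝ} (hα : 0 < α) {Ψ : ℝ → ℝ → ℝ}
    (hΨ : ContDiff ℝ 2 (uncurry Ψ)) (hs : HasCompactSupport (uncurry Ψ))
    (hD0 : ∀ R, Ψ R 0 = 0) (hD1 : ∀ R, Ψ R (π / 2) = 0)
    (horth : ∀ R, 0 < R → ∫ θ in Ioo 0 (π / 2), ellipticOp α Ψ R θ * kernelK θ = 0) :
    ∀ R, 0 < R → kMoment Ψ R = 0 := by
  -- regularity of the slices and of the moment
  have hΨ1 : ContDiff ℝ 1 (uncurry Ψ) := hΨ.of_le (by norm_num)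
  have hdz : ContDiff ℝ 1 (uncurry (dz Ψ)) := contDiff_dz_of_contDiff (n := 1) hΨ
  have hdzs : HasCompactSupport (uncurry (dz Ψ)) := hasCompactSupport_dz hs
  have hy : ContDiff ℝ 2 (kMoment Ψ) := contDiff_kMoment hΨ hs
  have hy' : deriv (kMoment Ψ) = kMoment (dz Ψ) := funext fun R => deriv_kMoment hΨ1 hs R
  have hy'' : ∀ R, deriv (deriv (kMoment Ψ)) R = kMoment (dz (dz Ψ)) R := fun R => by
    rw [hy', deriv_kMoment hdz hdzs R]
  obtain ⟨b, hb⟩ := exists_forall_le_eq_zero hs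
  have hyb : ∀ R, b ≤ R → kMoment Ψ R = 0 := fun R hR => by
    rw [kMoment_def]
    simp [hb R hR]
  refine eulerODE_eq_zero hy hα hyb fun R hR => ?_
  -- the slice `u = Ψ(R,·)` and its derivatives
  set u : ℝ → ℝ := fun θ => Ψ R θ with hu
  have huc : ContDiff ℝ 2 u := hΨ.comp (contDiff_const.prodMk contDiff_id)
  have hu' : deriv u = fun θ => dθ Ψ R θ := by funext θ; rfl
  have hu'' : deriv (deriv u) = fun θ => dθ (dθ Ψ) R θ := by rw [hu']; funext θ; rfl
  have hud : Differentiable ℝ u := huc.differentiable (by simp)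
  have huc1 : ContDiff ℝ 1 (deriv u) := by have := huc.iterate_deriv' 1 1; simpa using this
  have hcont_u : Continuous u := huc.continuous
  have hcont_u' : Continuous (deriv u) := huc1.continuous
  have hcont_u'' : Continuous (deriv (deriv u)) := huc1.continuous_deriv le_rfl
  -- continuity of the radial slices of `dz Ψ`, `dz (dz Ψ)`
  have hdz2c : Continuous (uncurry (dz (dz Ψ))) := continuous_dz hdz
  have hc1 : Continuous fun θ => dz Ψ R θ := hdz.continuous.comp (Continuous.prodMk_right R)
  have hc2 : Continuous fun θ => dz (dz Ψ) R θ := hdz2c.comp (Continuous.prodMk_right R)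
  -- the adjoint identity for the slice
  have hadj := integral_angularOp_mul_adjointMode huc (hD0 R) (hD1 R)
  rw [hu'', hu'] at hadj
  simp only [hu] at hadj
  -- pointwise on the open interval: `(α²R²Ψ_RR + α(5+α)RΨ_R)K = −L(Ψ)K + 3(−u''φ₀ + u' sin²cos + u(sin − 6φ₀))`
  have hpt : ∀ θ ∈ Ioo 0 (π / 2), (α ^ 2 * R ^ 2 * dz (dz Ψ) R θ + α * (5 + α) * R * dz Ψ R θ) * kernelK θ =
      -(ellipticOp α Ψ R θ * kernelK θ) + 3 * (-dθ (dθ Ψ) R θ * (Real.sin θ * Real.cos θ ^ 2) +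
        dθ Ψ R θ * (Real.sin θ ^ 2 * Real.cos θ) + Ψ R θ * (Real.sin θ - 6 * (Real.sin θ * Real.cos θ ^ 2))) := by
    intro θ hθ
    have hcos : Real.cos θ ≠ 0 := (Real.cos_pos_of_mem_Ioo ⟨by linarith [hθ.1, Real.pi_pos], hθ.2⟩).ne'
    rw [ellipticOp_eq_expanded α (hud θ) hcos]
    unfold kernelK
    field_simp
    ring
  -- integrability on the open interval of the continuous bounded pieces
  have hK : Continuous kernelK := continuous_kernelK
  have iL : IntegrableOn (fun θ => (α ^ 2 * R ^ 2 * dz (dz Ψ) R θ + α * (5 + α) * R * dz Ψ R θ) * kernelK θ) (Ioo 0 (π / 2)) :=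
    ((by fun_prop : Continuous fun θ => (α ^ 2 * R ^ 2 * dz (dz Ψ) R θ + α * (5 + α) * R * dz Ψ R θ) * kernelK θ)
      |>.continuousOn.integrableOn_Icc).mono_set Ioo_subset_Icc_self
  have iA : IntegrableOn (fun θ => 3 * (-dθ (dθ Ψ) R θ * (Real.sin θ * Real.cos θ ^ 2) +
      dθ Ψ R θ * (Real.sin θ ^ 2 * Real.cos θ) + Ψ R θ * (Real.sin θ - 6 * (Real.sin θ * Real.cos θ ^ 2)))) (Ioo 0 (π / 2)) := by
    have h1 : Continuous fun θ => dθ (dθ Ψ) R θ := by rw [← hu'']; exact hcont_u''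
    have h2 : Continuous fun θ => dθ Ψ R θ := by rw [← hu']; exact hcont_u'
    have h3 : Continuous fun θ => Ψ R θ := hcont_u
    exact ((by fun_prop : Continuous fun θ => 3 * (-dθ (dθ Ψ) R θ * (Real.sin θ * Real.cos θ ^ 2) +
      dθ Ψ R θ * (Real.sin θ ^ 2 * Real.cos θ) + Ψ R θ * (Real.sin θ - 6 * (Real.sin θ * Real.cos θ ^ 2))))
      |>.continuousOn.integrableOn_Icc).mono_set Ioo_subset_Icc_self
  have iP : IntegrableOn (fun θ => -(ellipticOp α Ψ R θ * kernelK θ)) (Ioo 0 (π / 2)) := by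
    have h := iL.sub iA
    refine (integrableOn_congr_fun (fun θ hθ => ?_) measurableSet_Ioo).1 h
    have := hpt θ hθ
    simp only [Pi.sub_apply] at *
    linarith
  -- assemble the ODE
  rw [hy'', hy', kMoment_def, kMoment_def, ← MeasureTheory.integral_const_mul, ← MeasureTheory.integral_const_mul, ← MeasureTheory.integral_add]
  rotate_left
  · exact ((hc2.mul hK).continuousOn.integrableOn_Icc.mono_set Ioo_subset_Icc_self).const_mul _
  · exact ((hc1.mul hK).continuousOn.integrableOn_Icc.mono_set Ioo_subset_Icc_self).const_mul _
  have e1 : ∫ θ in Ioo 0 (π / 2), (α ^ 2 * R ^ 2 * (dz (dz Ψ) R θ * kernelK θ) + α * (5 + α) * R * (dz Ψ R θ * kernelK θ)) =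
      ∫ θ in Ioo 0 (π / 2), (-(ellipticOp α Ψ R θ * kernelK θ) + 3 * (-dθ (dθ Ψ) R θ * (Real.sin θ * Real.cos θ ^ 2) +
        dθ Ψ R θ * (Real.sin θ ^ 2 * Real.cos θ) + Ψ R θ * (Real.sin θ - 6 * (Real.sin θ * Real.cos θ ^ 2)))) := by
    refine setIntegral_congr_fun measurableSet_Ioo fun θ hθ => ?_
    rw [← hpt θ hθ]
    ring
  rw [e1, MeasureTheory.integral_add iP iA, MeasureTheory.integral_neg, horth R hR, neg_zero, zero_add, MeasureTheory.integral_const_mul]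
  rw [← integral_Ioc_eq_integral_Ioo, ← intervalIntegral.integral_of_le (by positivity : (0 : ℝ) ≤ π / 2), hadj]
  simp

end Elgindi

end Literature.Analysis.FluidPDE
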